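import Mathlib
import Summits.Ventures.HodgeRepro.Tier4.Line2.BranchCoefficients
import Summits.Ventures.HodgeRepro.Tier4.Line2.TorsionEval

/-!
# Tier4/Line2/K1c — `aeval_subst_frobenius`, the statement VERBATIM from LINE L2's skeleton
(seat t4-L2-p2, gen 0; blind re-derivation cell `pub-hodge-repro`, Tier 4, README §9–§10)

K1c of `Tier4/Line2/Skeleton.lean` (t4-plan-2, v0.8, L285–L292): evaluating `F ∈ O.A⟦T_1, …, T_d⟧` at the
Frobenius-line point `(ζ^{p^{k_i}} − 1)_i` is evaluating its one-variable restriction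
`F((1+X)^{p^{k_1}} − 1, …, (1+X)^{p^{k_d}} − 1)` at `ζ − 1`.  The content is `aeval_subst_frobenius_generic`
(`Tier4/Line2/TorsionEval.lean`: Mathlib's `MvPowerSeries.eval₂_subst` transported from the discrete to the
ambient uniformity of the coefficients); this file instantiates it at a `BranchCoefficients` datum.  The
statement is byte-identical to the skeleton's so that the skeleton closes its `sorry` by this name.

Nothing here says anything about the status of the Hodge conjecture for CM abelian varieties, which is NOT
proved (HC_CM is NOT proved by anyone in this repository).
-/

set_option autoImplicit false

noncomputable section

namespace Summit.Ventures.HodgeRepro.Tier4.Line2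

/-- K1c — evaluating `F` at the Frobenius-line point `(ζ^{p^{k_i}} − 1)_i` is evaluating its one-variable
restriction at `ζ − 1` (PROVED: `aeval_subst_frobenius_generic`). -/
theorem aeval_subst_frobenius (O : BranchCoefficients) {d : ℕ} (F : MvPowerSeries (Fin d) O.A) (k : Fin d → ℕ)
    (ζ : 𝓞_ℂ_[O.p]) (hζ : PowerSeries.HasEval (ζ - 1))
    (hη : MvPowerSeries.HasEval (fun i : Fin d => ζ ^ O.p ^ k i - 1)) :
    MvPowerSeries.aeval hη F =
      PowerSeries.aeval hζ
        (MvPowerSeries.subst (fun i : Fin d => (1 + PowerSeries.X) ^ O.p ^ k i - 1 : Fin d → PowerSeries O.A) F) :=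
  aeval_subst_frobenius_generic F k ζ hζ hη

end Summit.Ventures.HodgeRepro.Tier4.Line2
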